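import Summits.Parity.BatemanHorn.Theorems.SoloInformedProgressionSystem

/-!
# The upper-bound sieve for rough values of a Bateman–Horn polynomial inside residue classes

Solo unit `solo-Parity-informed` (ideation tier, informed mode), session 14; `PLAN.md` §22.5(a), CLAIMS C63.

`exists_level_eventually_card_rough_residues_le`: for one Bateman–Horn polynomial `g` of degree `≥ 2`, a
finite set `S` of primes and sets `B_q` (`q ∈ S`) of NON-ROOTS of `g` modulo `q`, for every `δ > 0`
there is a level exponent `0 < c < 1` with

  `#{1 ≤ n ≤ N : |g(n)| has no prime factor < N^c, n mod q ∈ B_q (q ∈ S)}`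
    `≤ (∏_{q ∈ S} #B_q / (q - ρ_g(q))) · (2 C(g) + δ) N / log N`      for all large `N`.

Proof: split `n` by its residue `r` modulo `Q = ∏ S` (at most `∏ #B_q` residues, CRT injectivity),
write `n = Qm + r` and apply the one-polynomial sieve bound `SoloInformedPolynomialRoughValues` to the
Bateman–Horn system `G_r(X) = g(QX + r)` (`SoloInformedProgressionSystem`), whose constant is
`C(g) ∏_{q ∈ S} (1 - ρ_g(q)/q)⁻¹`; the local densities multiply out to `#B_q / (q - ρ_g(q))`.
With `#B_q ≤ q - ρ_g(q) - 1` (one missing non-root class) each prime of `S` saves a factor `1 - 1/q`.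
-/

namespace Summit.Parity.BatemanHorn.Theorems

open Finset Filter Polynomial
open scoped Topology
open Literature.NumberTheory.Sieve (polyRootCountMod IsBatemanHornSystem batemanHornConst primesProdBelow
  coprime_primesProdBelow_iff)

/-! ### Residues modulo a product of distinct primes -/

/-- CRT injectivity: the residues `r < ∏ S` with `r mod q ∈ B_q` for all `q ∈ S` number at most
`∏_{q ∈ S} #B_q`. -/
theorem card_filter_range_prod_mod_mem_le {S : Finset ℕ} (hS : ∀ q ∈ S, q.Prime) (B : ℕ → Finset ℕ) :
    #((range (∏ q ∈ S, q)).filter fun r : ℕ => ∀ q ∈ S, r % q ∈ B q) ≤ ∏ q ∈ S, #(B q) := by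
  classical
  rw [← card_pi]
  refine card_le_card_of_injOn (fun r => fun q _ => r % q) ?_ ?_
  · intro r hr
    rw [mem_coe, mem_filter] at hr
    rw [mem_coe, Finset.mem_pi]
    exact fun q hq => hr.2 q hq
  · intro r₁ hr₁ r₂ hr₂ h
    rw [mem_coe, mem_filter, mem_range] at hr₁ hr₂
    have hmod : ∀ q ∈ S, (q : ℤ) ∣ (r₁ : ℤ) - r₂ := by
      intro q hq
      have h1 : r₁ % q = r₂ % q := by
        have := congrFun (congrFun h q) hq
        exact this
      exact Nat.modEq_iff_dvd.mp (h1.symm : r₂ ≡ r₁ [MOD q])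
    have hcop : (S : Set ℕ).Pairwise (Function.onFun IsCoprime fun q : ℕ => (q : ℤ)) := by
      intro p hp q hq hpq
      rw [Function.onFun, Int.isCoprime_iff_gcd_eq_one, Int.gcd_natCast_natCast]
      exact (Nat.coprime_primes (hS p hp) (hS q hq)).mpr hpq
    have hdvd : ((∏ q ∈ S, q : ℕ) : ℤ) ∣ (r₁ : ℤ) - r₂ := by
      push_cast
      exact Finset.prod_dvd_of_coprime hcop hmod
    have habs : |(r₁ : ℤ) - r₂| < ((∏ q ∈ S, q : ℕ) : ℤ) := by
      rw [abs_sub_lt_iff]; constructor <;> omega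
    have := Int.eq_zero_of_abs_lt_dvd hdvd habs
    omega

/-! ### One residue class: reduction to the polynomial `g(QX + r)` -/

/-- The `n ≤ N`, `n ≡ r (mod Q)` with `|g(n)|` free of primes `< z` inject (`n ↦ ⌊n/Q⌋`) into `{0}` and the
`1 ≤ m ≤ ⌊N/Q⌋` with `|g(Qm + r)|` free of primes `< w`, whenever `w ≤ z`. -/
theorem card_rough_residue_le (g : ℤ[X]) (Q r N : ℕ) {z w : ℝ} (hwz : w ≤ z) :
    #((Icc 1 N).filter fun n : ℕ =>
        ((g.eval (n : ℤ)).natAbs).Coprime (primesProdBelow z) ∧ n % Q = r)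
      ≤ #((Icc 1 (N / Q)).filter fun m : ℕ =>
          (((g.comp (C (Q : ℤ) * X + C (r : ℤ))).eval (m : ℤ)).natAbs).Coprime (primesProdBelow w)) + 1 := by
  classical
  set A := (Icc 1 (N / Q)).filter fun m : ℕ =>
    (((g.comp (C (Q : ℤ) * X + C (r : ℤ))).eval (m : ℤ)).natAbs).Coprime (primesProdBelow w) with hA
  refine le_trans ?_ (card_insert_le 0 A)
  refine card_le_card_of_injOn (fun n : ℕ => n / Q) ?_ ?_
  · intro n hn
    rw [mem_coe, mem_filter, mem_Icc] at hn
    obtain ⟨⟨hn1, hnN⟩, hcop, hnr⟩ := hn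
    rw [mem_coe]
    change n / Q ∈ insert 0 A
    by_cases h0 : n / Q = 0
    · rw [h0]; exact mem_insert_self _ _
    refine mem_insert_of_mem ?_
    rw [hA, mem_filter, mem_Icc]
    refine ⟨⟨Nat.pos_of_ne_zero h0, Nat.div_le_div_right hnN⟩, ?_⟩
    have hn' : (Q : ℤ) * ((n / Q : ℕ) : ℤ) + (r : ℤ) = (n : ℤ) := by
      have := Nat.div_add_mod n Q
      rw [hnr] at this
      exact_mod_cast this
    have hev : (g.comp (C (Q : ℤ) * X + C (r : ℤ))).eval ((n / Q : ℕ) : ℤ) = g.eval (n : ℤ) := by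
      simp only [eval_comp, eval_add, eval_mul, eval_C, eval_X]
      rw [hn']
    rw [hev, coprime_primesProdBelow_iff]
    rw [coprime_primesProdBelow_iff] at hcop
    intro q hq
    refine hcop q ?_
    rw [Nat.mem_primesBelow] at hq ⊢
    exact ⟨lt_of_lt_of_le hq.1 (Nat.ceil_mono hwz), hq.2⟩
  · intro n₁ hn₁ n₂ hn₂ h
    rw [mem_coe, mem_filter] at hn₁ hn₂
    have h1 := Nat.div_add_mod n₁ Q
    have h2 := Nat.div_add_mod n₂ Q
    rw [hn₁.2.2] at h1
    rw [hn₂.2.2] at h2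
    have h' : n₁ / Q = n₂ / Q := by simpa using h
    calc n₁ = Q * (n₁ / Q) + r := h1.symm
      _ = Q * (n₂ / Q) + r := by rw [h']
      _ = n₂ := h2

/-! ### The local sieve bound -/

/-- **Rough values of `g` in prescribed non-root residue classes.** For a Bateman–Horn polynomial `g` of
degree `≥ 2`, a finite set `S` of primes, sets `B_q` of non-roots of `g` mod `q`, and `δ > 0`, there is
`0 < c < 1` with `#{1 ≤ n ≤ N : (|g(n)|, P(N^c)) = 1, n mod q ∈ B_q ∀ q ∈ S}
≤ (∏_{q ∈ S} #B_q/(q - ρ_g(q))) (2 C(g) + δ) N / log N` for all large `N`. -/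
theorem exists_level_eventually_card_rough_residues_le {g : ℤ[X]} (hg : IsBatemanHornSystem ![g])
    (hdeg : 2 ≤ g.natDegree) {S : Finset ℕ} (hS : ∀ q ∈ S, q.Prime) (B : ℕ → Finset ℕ)
    (hB : ∀ q ∈ S, ∀ b ∈ B q, ¬ (q : ℤ) ∣ g.eval (b : ℤ)) {δ : ℝ} (hδ : 0 < δ) :
    ∃ c : ℝ, 0 < c ∧ c < 1 ∧ ∀ᶠ N : ℕ in atTop,
      (#((Icc 1 N).filter fun n : ℕ =>
          ((g.eval (n : ℤ)).natAbs).Coprime (primesProdBelow ((N : ℝ) ^ c)) ∧ ∀ q ∈ S, n % q ∈ B q) : ℝ)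
        ≤ (∏ q ∈ S, (#(B q) : ℝ) / (q - polyRootCountMod ![g] q))
            * ((2 * batemanHornConst ![g] + δ) * N / Real.log N) := by
  classical
  -- the data
  obtain ⟨Q, hQdef⟩ : ∃ Q : ℕ, Q = ∏ q ∈ S, q := ⟨_, rfl⟩
  have hQpos : 0 < Q := by rw [hQdef]; exact prod_pos fun q hq => (hS q hq).pos
  have hQ0 : (0 : ℝ) < Q := by exact_mod_cast hQpos
  obtain ⟨Cg, hCgdef⟩ : ∃ Cg : ℝ, Cg = batemanHornConst ![g] := ⟨_, rfl⟩
  have hCg : 0 < Cg := by rw [hCgdef]; exact (IsBatemanHornSystem.hasBatemanHornConst_holds hg).2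
  rw [← hCgdef]
  have hρlt : ∀ q ∈ S, polyRootCountMod ![g] q < q := fun q hq => hg.hasNoFixedPrimeDivisor q (hS q hq)
  obtain ⟨K, hKdef⟩ : ∃ K : ℝ, K = ∏ q ∈ S, (1 - (polyRootCountMod ![g] q : ℝ) / q)⁻¹ := ⟨_, rfl⟩
  have hK0 : 0 < K := by
    rw [hKdef]
    refine prod_pos fun q hq => inv_pos.mpr (sub_pos.mpr ?_)
    rw [div_lt_one (by exact_mod_cast (hS q hq).pos)]
    exact_mod_cast hρlt q hq
  obtain ⟨P, hPdef⟩ : ∃ P : ℕ, P = ∏ q ∈ S, #(B q) := ⟨_, rfl⟩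
  obtain ⟨β, hβdef⟩ : ∃ β : ℝ, β = ∏ q ∈ S, (#(B q) : ℝ) / (q - polyRootCountMod ![g] q) :=
    ⟨_, rfl⟩
  have hβ0 : 0 ≤ β := by
    rw [hβdef]
    exact prod_nonneg fun q hq => div_nonneg (Nat.cast_nonneg _)
      (sub_nonneg.mpr (by exact_mod_cast (hρlt q hq).le))
  rw [← hβdef]
  -- `P K / Q = β`
  have hPKQ : (P : ℝ) * K / Q = β := by
    rw [hPdef, hKdef, hQdef, hβdef]
    push_cast
    rw [← prod_mul_distrib, ← prod_div_distrib]
    refine prod_congr rfl fun q hq => ?_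
    have hq0 : (q : ℝ) ≠ 0 := by exact_mod_cast (hS q hq).ne_zero
    have hqρ : (q : ℝ) - polyRootCountMod ![g] q ≠ 0 :=
      sub_ne_zero.mpr (by exact_mod_cast (hρlt q hq).ne')
    field_simp
  -- the admissible residues mod `Q`
  set Rset := (range Q).filter (fun r : ℕ => ∀ q ∈ S, r % q ∈ B q) with hRset
  have hRcard : #Rset ≤ P := by
    rw [hRset, hPdef, hQdef]; exact card_filter_range_prod_mod_mem_le hS B
  have hdvdQ : ∀ {p : ℕ}, p.Prime → p ∣ Q → p ∈ S := by
    intro p hp hpQ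
    rw [hQdef, hp.prime.dvd_finsetProd_iff] at hpQ
    obtain ⟨q, hq, hpq⟩ := hpQ
    rwa [(Nat.prime_dvd_prime_iff_eq hp (hS q hq)).mp hpq]
  have hqQ : ∀ q ∈ S, q ∣ Q := fun q hq => by rw [hQdef]; exact dvd_prod_of_mem _ hq
  have hRgood : ∀ r ∈ Rset, ∀ p : ℕ, p.Prime → p ∣ Q → ¬ (p : ℤ) ∣ g.eval (r : ℤ) := by
    intro r hr p hp hpQ hdvd
    rw [hRset, mem_filter] at hr
    have hpS : p ∈ S := hdvdQ hp hpQ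
    apply hB p hpS (r % p) (hr.2 p hpS)
    have h1 : (p : ℤ) ∣ (r : ℤ) - ((r % p : ℕ) : ℤ) := by
      refine ⟨((r / p : ℕ) : ℤ), ?_⟩
      have h := Nat.div_add_mod r p
      have h' : (r : ℤ) = (p : ℤ) * ((r / p : ℕ) : ℤ) + ((r % p : ℕ) : ℤ) := by exact_mod_cast h.symm
      linear_combination h'
    have h2 := sub_dvd_eval_sub (r : ℤ) ((r % p : ℕ) : ℤ) g
    exact (dvd_sub_right hdvd).mp (h1.trans h2)
  have hRgood' : ∀ r ∈ Rset, ∀ q ∈ S, ¬ (q : ℤ) ∣ g.eval (r : ℤ) := fun r hr q hq =>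
    hRgood r hr q (hS q hq) (hqQ q hq)
  -- every counted `n` reduces to an admissible residue
  have hmodR : ∀ {z : ℝ} {N n : ℕ}, n ∈ (Icc 1 N).filter (fun n : ℕ =>
      ((g.eval (n : ℤ)).natAbs).Coprime (primesProdBelow z) ∧ ∀ q ∈ S, n % q ∈ B q) → n % Q ∈ Rset := by
    intro z N n hn
    rw [mem_filter] at hn
    rw [hRset, mem_filter, mem_range]
    refine ⟨Nat.mod_lt _ hQpos, fun q hq => ?_⟩
    rw [Nat.mod_mod_of_dvd n (hqQ q hq)]
    exact hn.2.2 q hq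
  -- the trivial case: some `B_q` is empty
  rcases Nat.eq_zero_or_pos P with hP0 | hPpos
  · refine ⟨1 / 2, by norm_num, by norm_num, Filter.Eventually.of_forall fun N => ?_⟩
    have hβ : β = 0 := by
      rw [hPdef] at hP0
      obtain ⟨q, hq, hq0⟩ := prod_eq_zero_iff.mp hP0
      rw [hβdef]
      exact prod_eq_zero hq (by rw [hq0, Nat.cast_zero, zero_div])
    have hempty : Rset = ∅ := card_eq_zero.mp (by omega)
    have hT : #((Icc 1 N).filter fun n : ℕ =>
        ((g.eval (n : ℤ)).natAbs).Coprime (primesProdBelow ((N : ℝ) ^ (1 / 2 : ℝ)))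
          ∧ ∀ q ∈ S, n % q ∈ B q) = 0 := by
      rw [card_eq_zero, ← not_nonempty_iff_eq_empty]
      rintro ⟨n, hn⟩
      have hmem := hmodR hn
      rw [hempty] at hmem
      exact absurd hmem (Finset.notMem_empty _)
    rw [hT, hβ]
    simp
  -- the main case: `β > 0`
  have hBpos : ∀ q ∈ S, 0 < #(B q) := fun q hq => Nat.pos_of_ne_zero fun h =>
    hPpos.ne' (by rw [hPdef]; exact prod_eq_zero hq h)
  have hβpos : 0 < β := by
    rw [hβdef]
    exact prod_pos fun q hq => div_pos (by exact_mod_cast hBpos q hq)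
      (sub_pos.mpr (by exact_mod_cast hρlt q hq))
  have hP0 : (0 : ℝ) < P := by exact_mod_cast hPpos
  -- parameters `ε`, `δ'`
  obtain ⟨ε, hεdef⟩ : ∃ ε : ℝ, ε = min 1 (δ / (6 * Cg)) := ⟨_, rfl⟩
  have hε0 : 0 < ε := by rw [hεdef]; exact lt_min one_pos (by positivity)
  have hε1 : ε ≤ 1 := by rw [hεdef]; exact min_le_left _ _
  have hεC : 2 * Cg * ε ≤ δ / 3 := by
    have h : ε ≤ δ / (6 * Cg) := by rw [hεdef]; exact min_le_right _ _
    calc 2 * Cg * ε ≤ 2 * Cg * (δ / (6 * Cg)) := mul_le_mul_of_nonneg_left h (by positivity)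
      _ = δ / 3 := by field_simp; ring
  obtain ⟨δ', hδ'def⟩ : ∃ δ' : ℝ, δ' = β * δ * Q / (6 * P) := ⟨_, rfl⟩
  have hδ'0 : 0 < δ' := by rw [hδ'def]; positivity
  have hδ'P : δ' * P / Q = β * δ / 6 := by rw [hδ'def]; field_simp
  -- the sieve in each admissible residue class
  have hloc : ∀ r ∈ Rset, ∃ c : ℝ, 0 < c ∧ c < 1 ∧ ∀ᶠ M : ℕ in atTop,
      (#((Icc 1 M).filter fun m : ℕ =>
          (((g.comp (C (Q : ℤ) * X + C (r : ℤ))).eval (m : ℤ)).natAbs).Coprime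
            (primesProdBelow ((M : ℝ) ^ c))) : ℝ) ≤ (2 * (Cg * K) + δ') * M / Real.log M := by
    intro r hr
    have hGsys := isBatemanHornSystem_comp_C_mul_X_add_C hg hQpos.ne' (hRgood r hr)
    have hGdeg : 2 ≤ (g.comp (C (Q : ℤ) * X + C (r : ℤ))).natDegree := by
      rw [natDegree_comp_C_mul_X_add_C (by exact_mod_cast hQpos.ne') (r : ℤ)]
      exact hdeg
    have hconst : batemanHornConst ![g.comp (C (Q : ℤ) * X + C (r : ℤ))] = Cg * K := by
      rw [hCgdef, hKdef, hQdef]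
      exact batemanHornConst_comp_C_mul_X_add_C hg hS (hRgood' r hr)
    obtain ⟨c, hc0, hc1, hev⟩ := exists_level_eventually_card_rough_le hGsys hGdeg hδ'0
    rw [hconst] at hev
    exact ⟨c, hc0, hc1, hev⟩
  choose! cf hcf0 hcf1 hcfev using hloc
  -- the level exponent: `c = max (1/2, max_r c_r)`
  obtain ⟨c, hcdef⟩ : ∃ c : ℝ, c = (insert (1 / 2 : ℝ) (Rset.image cf)).max' (insert_nonempty _ _) :=
    ⟨_, rfl⟩
  have hc0 : 0 < c := by
    rw [hcdef]
    exact lt_of_lt_of_le one_half_pos (le_max' _ _ (mem_insert_self _ _))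
  have hc1 : c < 1 := by
    rw [hcdef, Finset.max'_lt_iff]
    intro y hy
    rcases mem_insert.mp hy with rfl | hy'
    · norm_num
    · obtain ⟨r, hr, rfl⟩ := mem_image.mp hy'
      exact hcf1 r hr
  have hcr : ∀ r ∈ Rset, cf r ≤ c := fun r hr => by
    rw [hcdef]
    exact le_max' _ _ (mem_insert_of_mem (mem_image_of_mem _ hr))
  refine ⟨c, hc0, hc1, ?_⟩
  -- eventual facts in `N`
  have hMtend : Tendsto (fun N : ℕ => N / Q) atTop atTop := by
    refine tendsto_atTop_atTop.mpr fun b => ⟨b * Q, fun N hN => ?_⟩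
    exact (Nat.le_div_iff_mul_le hQpos).mpr hN
  have E1 : ∀ᶠ N : ℕ in atTop, ∀ r ∈ Rset,
      (#((Icc 1 (N / Q)).filter fun m : ℕ =>
          (((g.comp (C (Q : ℤ) * X + C (r : ℤ))).eval (m : ℤ)).natAbs).Coprime
            (primesProdBelow (((N / Q : ℕ) : ℝ) ^ cf r))) : ℝ)
        ≤ (2 * (Cg * K) + δ') * ((N / Q : ℕ) : ℝ) / Real.log ((N / Q : ℕ) : ℝ) :=
    hMtend.eventually ((eventually_all_finset Rset).mpr fun r hr => hcfev r hr)
  obtain ⟨L, hLdef⟩ : ∃ L : ℝ, L = Real.log (2 * Q) := ⟨_, rfl⟩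
  have hQ1 : (1 : ℝ) ≤ Q := by exact_mod_cast hQpos
  have hL0 : 0 < L := by rw [hLdef]; exact Real.log_pos (by linarith)
  have E2 : ∀ᶠ N : ℕ in atTop, 2 * Q ≤ N := eventually_ge_atTop _
  have E3 : ∀ᶠ N : ℕ in atTop, (1 + ε) * L / ε ≤ Real.log N := by
    filter_upwards [eventually_ge_atTop ⌈Real.exp ((1 + ε) * L / ε)⌉₊, eventually_gt_atTop 0]
      with N hN hN0
    rw [Real.le_log_iff_exp_le (by exact_mod_cast hN0)]
    exact (Nat.le_ceil _).trans (by exact_mod_cast hN)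
  have E4 : ∀ᶠ N : ℕ in atTop, (P : ℝ) * Real.log N ≤ β * δ / 3 * N := by
    have hlo := (Real.isLittleO_log_id_atTop.comp_tendsto tendsto_natCast_atTop_atTop).def
      (show 0 < β * δ / 3 / P by positivity)
    filter_upwards [hlo] with N hN
    simp only [Function.comp_apply, id_eq, Real.norm_eq_abs, Nat.abs_cast] at hN
    have h := (le_abs_self _).trans hN
    calc (P : ℝ) * Real.log N ≤ P * (β * δ / 3 / P * N) := mul_le_mul_of_nonneg_left h hP0.le
      _ = β * δ / 3 * N := by field_simp
  filter_upwards [E1, E2, E3, E4] with N h1 h2 h3 h4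
  -- the setting at `N`
  set M : ℕ := N / Q with hMdef
  have hN2 : (2 : ℝ) ≤ N := by exact_mod_cast le_trans (by omega) h2
  have hN0 : (0 : ℝ) < N := by linarith
  have hM2 : 2 ≤ M := (Nat.le_div_iff_mul_le hQpos).mpr h2
  have hMreal : (M : ℝ) ≤ N / Q := by rw [hMdef]; exact Nat.cast_div_le
  have hMlow : (N : ℝ) / (2 * Q) ≤ M := by
    have h' : (N : ℝ) < M * Q + Q := by
      have : N < M * Q + Q := by rw [hMdef]; exact Nat.lt_div_mul_add hQpos
      exact_mod_cast this
    have h2' : (2 : ℝ) * Q ≤ N := by exact_mod_cast h2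
    rw [div_le_iff₀ (by positivity)]
    nlinarith
  have hlogN : 0 < Real.log N := Real.log_pos (by linarith)
  have hlogM : 0 < Real.log M := Real.log_pos (by exact_mod_cast lt_of_lt_of_le one_lt_two hM2)
  have hlogNM : Real.log N ≤ (1 + ε) * Real.log M := by
    have hlogM' : Real.log N - L ≤ Real.log M := by
      rw [hLdef, ← Real.log_div hN0.ne' (by positivity)]
      exact Real.log_le_log (by positivity) hMlow
    have h3' : (1 + ε) * L ≤ ε * Real.log N := by
      have := h3
      rw [div_le_iff₀ hε0] at this
      linarith
    calc Real.log N ≤ (1 + ε) * (Real.log N - L) := by linarith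
      _ ≤ (1 + ε) * Real.log M := mul_le_mul_of_nonneg_left hlogM' (by linarith)
  -- combinatorics: split by residues mod `Q`, reduce each class to `g(QX + r)`
  set T := (Icc 1 N).filter (fun n : ℕ =>
    ((g.eval (n : ℤ)).natAbs).Coprime (primesProdBelow ((N : ℝ) ^ c)) ∧ ∀ q ∈ S, n % q ∈ B q) with hT
  have hmaps : (T : Set ℕ).MapsTo (fun n : ℕ => n % Q) Rset := fun n hn => hmodR hn
  have hTsum : #T = ∑ r ∈ Rset, #(T.filter fun n : ℕ => n % Q = r) := card_eq_sum_card_fiberwise hmaps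
  have hTr : ∀ r ∈ Rset, #(T.filter fun n : ℕ => n % Q = r)
      ≤ #((Icc 1 M).filter fun m : ℕ =>
          (((g.comp (C (Q : ℤ) * X + C (r : ℤ))).eval (m : ℤ)).natAbs).Coprime
            (primesProdBelow ((M : ℝ) ^ cf r))) + 1 := by
    intro r hr
    have hwz : (M : ℝ) ^ cf r ≤ (N : ℝ) ^ c := by
      have hMN : (M : ℝ) ≤ N := by exact_mod_cast Nat.div_le_self N Q
      calc (M : ℝ) ^ cf r ≤ (N : ℝ) ^ cf r := Real.rpow_le_rpow (Nat.cast_nonneg _) hMN (hcf0 r hr).le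
        _ ≤ (N : ℝ) ^ c := Real.rpow_le_rpow_of_exponent_le (by linarith) (hcr r hr)
    refine le_trans (card_le_card ?_) (card_rough_residue_le g Q r N hwz)
    intro n hn
    rw [hT, mem_filter, mem_filter] at hn
    rw [mem_filter]
    exact ⟨hn.1.1, hn.1.2.1, hn.2⟩
  -- numerics
  have hcardR : (#Rset : ℝ) ≤ P := by exact_mod_cast hRcard
  have step1 : (#T : ℝ) ≤ P * ((2 * (Cg * K) + δ') * M / Real.log M + 1) := by
    calc (#T : ℝ) = ∑ r ∈ Rset, (#(T.filter fun n : ℕ => n % Q = r) : ℝ) := by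
          rw [hTsum]; push_cast; rfl
      _ ≤ ∑ r ∈ Rset, ((2 * (Cg * K) + δ') * M / Real.log M + 1) := by
          refine sum_le_sum fun r hr => ?_
          have ha : (#(T.filter fun n : ℕ => n % Q = r) : ℝ)
              ≤ #((Icc 1 M).filter fun m : ℕ =>
                  (((g.comp (C (Q : ℤ) * X + C (r : ℤ))).eval (m : ℤ)).natAbs).Coprime
                    (primesProdBelow ((M : ℝ) ^ cf r))) + 1 := by
            exact_mod_cast hTr r hr
          linarith [h1 r hr]
      _ = #Rset * ((2 * (Cg * K) + δ') * M / Real.log M + 1) := by rw [sum_const, nsmul_eq_mul]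
      _ ≤ P * ((2 * (Cg * K) + δ') * M / Real.log M + 1) :=
          mul_le_mul_of_nonneg_right hcardR (by positivity)
  have step2 : (P : ℝ) * ((2 * (Cg * K) + δ') * M / Real.log M)
      ≤ (2 * Cg * β + β * δ / 6) * (1 + ε) * N / Real.log N := by
    have hinv : 1 / Real.log M ≤ (1 + ε) / Real.log N := by
      rw [div_le_div_iff₀ hlogM hlogN, one_mul]
      exact hlogNM
    calc (P : ℝ) * ((2 * (Cg * K) + δ') * M / Real.log M)
        = (P * (2 * (Cg * K) + δ') * M) * (1 / Real.log M) := by ring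
      _ ≤ (P * (2 * (Cg * K) + δ') * (N / Q)) * ((1 + ε) / Real.log N) :=
          mul_le_mul (mul_le_mul_of_nonneg_left hMreal (by positivity)) hinv (by positivity)
            (by positivity)
      _ = (2 * Cg * (P * K / Q) + δ' * P / Q) * (1 + ε) * N / Real.log N := by ring
      _ = (2 * Cg * β + β * δ / 6) * (1 + ε) * N / Real.log N := by rw [hPKQ, hδ'P]
  have step3 : (2 * Cg * β + β * δ / 6) * (1 + ε) ≤ 2 * Cg * β + 2 * (β * δ) / 3 := by
    have h1' : 2 * Cg * β * ε ≤ β * (δ / 3) := by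
      calc 2 * Cg * β * ε = β * (2 * Cg * ε) := by ring
        _ ≤ β * (δ / 3) := mul_le_mul_of_nonneg_left hεC hβ0
    have h2' : β * δ / 6 * ε ≤ β * δ / 6 := by
      calc β * δ / 6 * ε ≤ β * δ / 6 * 1 := mul_le_mul_of_nonneg_left hε1 (by positivity)
        _ = β * δ / 6 := mul_one _
    linarith
  have step4 : (P : ℝ) ≤ β * δ / 3 * N / Real.log N := by
    rw [le_div_iff₀ hlogN]
    exact h4
  calc (#T : ℝ) ≤ P * ((2 * (Cg * K) + δ') * M / Real.log M + 1) := step1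
    _ = P * ((2 * (Cg * K) + δ') * M / Real.log M) + P := by ring
    _ ≤ (2 * Cg * β + β * δ / 6) * (1 + ε) * N / Real.log N + β * δ / 3 * N / Real.log N :=
        add_le_add step2 step4
    _ ≤ (2 * Cg * β + 2 * (β * δ) / 3) * N / Real.log N + β * δ / 3 * N / Real.log N := by
        have h := div_le_div_of_nonneg_right (mul_le_mul_of_nonneg_right step3 hN0.le) hlogN.le
        linarith
    _ = β * ((2 * Cg + δ) * N / Real.log N) := by ring

end Summit.Parity.BatemanHorn.Theorems
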